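import Summits.AnomalousDissipation.AnomalousDissipation.Theorems.ScalarAnomalySteadySourceFormal.Negative.ShearNoGo
import Literature.Barriers.AnomalousDissipation.GravestModeLaminarAttractorSwept

/-!
# Negative knowledge for the crux `ScalarAnomalySteadySourceFormal` (stmt-AnomalousDissipation-0448), VII-i:
# the Galilean-swept Marchioro family carries no scalar anomaly

Certified copy of §9.9 of the cdisprove work file.  Application of the shear–drift no-go
(`Negative.ShearNoGo.shearDrift_not_anomalous`) to the explicit bounded-energy Navier–Stokes family
of the route repair (crux #3′, stmt-10786): the swept first-mode states
`Literature.Barriers.AnomalousDissipation.marchioroSweptState α ν_j m` (momentum `m` with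
`m 0 ≠ 0`, any `α`, any `ν_j → 0`) — exact global Leray–Hopf solutions for the steady first-shell
force `marchioroForce α` with mean energy bounded uniformly in `ν`
(`exists_firstMode_boundedMeanEnergy_family`).  **Theorem** (`sweptMarchioro_not_anomalous`): for
ONE smooth mean-zero source `h`, ANY `L²` data and ANY weak solutions `θ_j` of the crux's class
advected by these flows, bounded scalar variance excludes a dissipation floor.  So the clause bundle
of the crux cannot be met "for the wrong reason" by Galilean sweeping: at non-zero momentum the
planar prerequisite is cheap but the scalar is laminar.

Tools: `weakOn_congr_velocity` (the weak formulation only sees the velocity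
on `(0,T)`, so the swept state may be frozen at negative times, where its formula is unbounded),
the axis/transversality/continuity/detuning facts of the barrier file.

Supports stmt-AnomalousDissipation-0448.
-/

set_option linter.dupNamespace false

noncomputable section

open scoped BigOperators Topology ENNReal NNReal InnerProductSpace ContDiff
open Filter Set Function MeasureTheory UnitAddTorus Complex

namespace Summit.AnomalousDissipation.AnomalousDissipation.Theorems.ScalarAnomalySteadySourceFormal.Negative

open Literature.Analysis
open Literature.Analysis.FunctionSpaces Literature.Analysis.FunctionSpaces.Torus
open Literature.Analysis.FluidPDE Literature.Analysis.FluidPDE.Torus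
open Literature.Barriers.AnomalousDissipation

section Congr

variable {d : Type*} [Fintype d]
variable {T κ : ℝ} {u u' : ℝ → UnitAddTorus d → EuclideanSpace ℝ d} {s : ℝ → UnitAddTorus d → ℝ}
  {θ₀ : UnitAddTorus d → ℝ} {θ : ℝ → UnitAddTorus d → ℝ}

/-- **The weak formulation only sees the velocity on `(0,T)`**: two velocity fields that agree at
every `t ∈ (0,T)` have the same weak solutions on `[0,T)`. [folklore] -/
theorem weakOn_congr_velocity (hw : IsWeakScalarTransportForcedOn T κ u s θ₀ θ)
    (huu' : ∀ t ∈ Ioo 0 T, u' t = u t) : IsWeakScalarTransportForcedOn T κ u' s θ₀ θ := by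
  have hst : ∀ p ∈ Ioo (0 : ℝ) T ×ˢ (univ : Set (EuclideanSpace ℝ d)), stLift u' p = stLift u p := by
    rintro ⟨t, y⟩ ⟨ht, -⟩
    simp only [stLift, huu' t ht]
  have hae : ∀ᵐ t ∂((volume : Measure ℝ).restrict (Ioo 0 T)), u' t = u t :=
    (ae_restrict_iff' measurableSet_Ioo).2 (Eventually.of_forall huu')
  refine ⟨hw.aestronglyMeasurable, ?_, hw.aestronglyMeasurable_source, hw.ae_lintegral_sq_le, ?_, ?_,
    hw.lintegral_source_lt_top, ?_, ?_⟩
  · exact hw.aestronglyMeasurable_velocity.congr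
      ((ae_restrict_iff' (measurableSet_Ioo.prod MeasurableSet.univ)).2 (Eventually.of_forall fun p hp => (hst p hp).symm))
  · refine lt_of_le_of_lt (le_of_eq (setLIntegral_congr_fun measurableSet_Ioo ?_)) hw.lintegral_velocity_lt_top
    exact fun t ht => by simp only [huu' t ht]
  · refine lt_of_le_of_lt (le_of_eq (setLIntegral_congr_fun measurableSet_Ioo ?_)) hw.lintegral_mul_lt_top
    exact fun t ht => by simp only [huu' t ht]
  · filter_upwards [hw.ae_isWeaklyDivFree, hae] with t ht he
    rw [he]; exact ht
  · intro ψ hψ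
    have e : ∫ t in Ioo 0 T, ∫ x, θ t x *
        (FunctionSpaces.Torus.timeDeriv ψ t x + ⟪u' t x, FunctionSpaces.Torus.gradient (ψ t) x⟫_ℝ +
          κ * FunctionSpaces.Torus.laplacian (ψ t) x) =
        ∫ t in Ioo 0 T, ∫ x, θ t x *
        (FunctionSpaces.Torus.timeDeriv ψ t x + ⟪u t x, FunctionSpaces.Torus.gradient (ψ t) x⟫_ℝ +
          κ * FunctionSpaces.Torus.laplacian (ψ t) x) :=
      setIntegral_congr_fun measurableSet_Ioo fun t ht => by simp only [huu' t ht]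
    rw [e]
    exact hw.weak_eq ψ hψ

/-- Global version of `weakOn_congr_velocity`: agreement at all positive times. [folklore] -/
theorem weak_congr_velocity (hw : IsWeakScalarTransportForced κ u s θ₀ θ)
    (huu' : ∀ t, 0 < t → u' t = u t) : IsWeakScalarTransportForced κ u' s θ₀ θ :=
  fun T hT => weakOn_congr_velocity (hw T hT) fun t ht => huu' t ht.1

end Congr

section Swept

/-- The frequency lattice `ℤ²` (local notation). -/
local notation "ℤ²" => Fin 2 → ℤ
/-- Velocity values (local notation). -/
local notation "E²" => EuclideanSpace ℝ (Fin 2)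

/-- The axis part of the first frequency shell: `{k : |k|² ≤ 1, k 1 = 0} = {0, ±e₀}`. [folklore] -/
def axisBall : Finset ℤ² := (freqBall 1).filter fun k => k 1 = 0

/-- The axis ball lies on the axis with `|k 0| ≤ 1`. [folklore] -/
theorem axisBall_axis : ∀ k ∈ axisBall, k 1 = 0 ∧ |k 0| ≤ (1 : ℕ) := by
  intro k hk
  simp only [axisBall, Finset.mem_filter, mem_freqBall] at hk
  refine ⟨hk.2, ?_⟩
  have h1 : freqNormSq k = ((k 0 : ℤ) : ℝ) ^ 2 := by
    rw [freqNormSq, Fin.sum_univ_two, hk.2]; push_cast; ring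
  have h2 : ((k 0 : ℤ) : ℝ) ^ 2 ≤ 1 := by rw [← h1]; simpa using hk.1
  have h3 : |((k 0 : ℤ) : ℝ)| ≤ 1 := by
    rw [← Real.sqrt_sq_eq_abs, ← Real.sqrt_one]; exact Real.sqrt_le_sqrt h2
  rw [Nat.cast_one]
  exact_mod_cast h3

/-- The swept state is a real trigonometric polynomial over the axis ball (its `±e₁` modes vanish). [folklore] -/
theorem marchioroSweptState_eq_axis (α ν : ℝ) (m : E²) (t : ℝ) :
    marchioroSweptState α ν m t = realTrigPoly axisBall (sweptCoeff α ν m t) := by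
  rw [marchioroSweptState_eq, realTrigPoly_eq_comp, realTrigPoly_eq_comp,
    trigPoly_subset (Finset.filter_subset (fun k : ℤ² => k 1 = 0) (freqBall 1)) fun k _ hk => ?_]
  · rfl
  · simp only [Finset.mem_filter, not_and] at hk
    by_cases hkb : k ∈ freqBall 1
    · exact sweptCoeff_eq_zero_of_apply_one_ne_zero t (hk hkb)
    · exact sweptCoeff_eq_zero_of_not_mem_freqBall t hkb

/-- The swept coefficients frozen at negative times: `c̃(t) = ĉ(max t 0)`. [folklore] -/
def sweptCoeffPos (α ν : ℝ) (m : E²) (t : ℝ) (k : ℤ²) : EuclideanSpace ℂ (Fin 2) :=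
  sweptCoeff α ν m (max t 0) k

/-- Transversality of the frozen coefficients. [folklore] -/
theorem zdot_sweptCoeffPos (α ν : ℝ) (m : E²) (t : ℝ) (k : ℤ²) : zdot k (sweptCoeffPos α ν m t k) = 0 :=
  sum_mul_sweptCoeff α ν m (max t 0) k

/-- Continuity of the frozen coefficient paths. [folklore] -/
theorem continuous_sweptCoeffPos (α : ℝ) {ν : ℝ} (hν : 0 < ν) (m : E²) (k : ℤ²) :
    Continuous fun t => sweptCoeffPos α ν m t k :=
  (continuous_sweptCoeff (α := α) (m := m) hν k).comp (continuous_id.max continuous_const)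

/-- A `ν`-uniform bound on the force coefficients: `‖f̂_α(k)‖ ≤ ‖c_α‖`. [folklore] -/
theorem norm_marchioroForceCoeff_le (α : ℝ) (k : ℤ²) : ‖marchioroForceCoeff α k‖ ≤ ‖firstModeCoeff α‖ := by
  rw [marchioroForceCoeff_eq, norm_smul, norm_inv, Complex.norm_ofNat]
  have h1 : ‖(if k = firstModeFreq then firstModeCoeff α else 0) +
      EuclideanSpace.conjVec (if k = -firstModeFreq then firstModeCoeff α else 0)‖ ≤
      ‖firstModeCoeff α‖ + ‖firstModeCoeff α‖ := by
    refine (norm_add_le _ _).trans (add_le_add ?_ ?_)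
    · split_ifs <;> simp
    · rw [EuclideanSpace.norm_conjVec]; split_ifs <;> simp
  calc 2⁻¹ * ‖(if k = firstModeFreq then firstModeCoeff α else 0) +
        EuclideanSpace.conjVec (if k = -firstModeFreq then firstModeCoeff α else 0)‖
      ≤ 2⁻¹ * (‖firstModeCoeff α‖ + ‖firstModeCoeff α‖) := by gcongr
    _ = ‖firstModeCoeff α‖ := by ring

/-- **Uniform-in-`ν` bound on the frozen swept coefficients** (detuning: `m 0 ≠ 0`):
`‖c̃(t)(k)‖ ≤ max ‖m‖ (‖c_α‖/(π|m₀|))`. [folklore] -/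
theorem norm_sweptCoeffPos_le (α : ℝ) {ν : ℝ} (hν : 0 ≤ ν) {m : E²} (hm : m 0 ≠ 0) (t : ℝ) (k : ℤ²) :
    ‖sweptCoeffPos α ν m t k‖ ≤ max ‖m‖ ((Real.pi * |m 0|)⁻¹ * ‖firstModeCoeff α‖) := by
  unfold sweptCoeffPos
  by_cases hk : k = 0
  · subst hk
    rw [sweptCoeff_zero_freq, EuclideanSpace.norm_complexify]
    exact le_max_left _ _
  · refine le_max_of_le_right ((norm_sweptCoeff_le hν hm (le_max_right t 0) hk).trans ?_)
    exact mul_le_mul_of_nonneg_left (norm_marchioroForceCoeff_le α k) (by positivity)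

/-- The swept velocity frozen at negative times, as a trigonometric polynomial over the axis ball. [folklore] -/
theorem marchioroSweptState_max_eq (α ν : ℝ) (m : E²) (t : ℝ) :
    marchioroSweptState α ν m (max t 0) = realTrigPoly axisBall (sweptCoeffPos α ν m t) :=
  marchioroSweptState_eq_axis α ν m (max t 0)

variable {h : UnitAddTorus (Fin 2) → ℝ}

/-- **NO SCALAR ANOMALY ON THE GALILEAN-SWEPT MARCHIORO FAMILY.**  For a momentum with `m 0 ≠ 0`,
any amplitude `α`, viscosities `ν_j → 0`, one smooth mean-zero source `h`, arbitrary `L²` data and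
arbitrary weak solutions `θ_j` of the forced scalar equation advected by the swept states
`marchioroSweptState α ν_j m`: bounded scalar variance excludes a positive dissipation floor. [folklore] -/
theorem sweptMarchioro_not_anomalous (α : ℝ) {m : E²} (hm : m 0 ≠ 0) (hh : IsSmooth h) (hmean : HasZeroMean h)
    {νs : ℕ → ℝ} (hν : ∀ j, 0 < νs j) (hν0 : Tendsto νs atTop (nhds 0))
    {θ₀s : ℕ → UnitAddTorus (Fin 2) → ℝ} (hθ₀ : ∀ j, MemLp (θ₀s j) 2 volume)
    {θs : ℕ → ℝ → UnitAddTorus (Fin 2) → ℝ}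
    (hweak : ∀ j, IsWeakScalarTransportForced (νs j) (marchioroSweptState α (νs j) m) (fun _ => h) (θ₀s j) (θs j))
    {E : ℝ} (hV : ∀ j, longTimeAvgSup (fun t => scalarL2Sq (θs j t)) ≤ E) :
    ¬ ∃ ε : ℝ, 0 < ε ∧ ∀ j, ε ≤ longTimeAvgSup (fun t => νs j * (eScalarGradNormSq (θs j t)).toReal) := by
  set Mb : ℝ := max ‖m‖ ((Real.pi * |m 0|)⁻¹ * ‖firstModeCoeff α‖) with hMb
  have hMb0 : 0 ≤ Mb := le_max_of_le_left (norm_nonneg _)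
  have hweak' : ∀ j, IsWeakScalarTransportForced (νs j) (fun t => marchioroSweptState α (νs j) m (max t 0))
      (fun _ => h) (θ₀s j) (θs j) :=
    fun j => weak_congr_velocity (hweak j) fun t ht => by rw [max_eq_left ht.le]
  exact shearDrift_not_anomalous (S := axisBall) (R := 1) (M := Mb) hh hmean axisBall_axis hMb0 hν hν0
    (cs := fun j => sweptCoeffPos α (νs j) m) (fun j k => continuous_sweptCoeffPos α (hν j) m k)
    (fun j s k => norm_sweptCoeffPos_le α (hν j).le hm s k) (fun j s k _ => zdot_sweptCoeffPos α (νs j) m s k)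
    (us := fun j t => marchioroSweptState α (νs j) m (max t 0)) (fun j s => marchioroSweptState_max_eq α (νs j) m s)
    hθ₀ hweak' hV

/-- The same in the clause vocabulary of `Negative.KillShape`: a candidate family of the crux riding
the swept Marchioro flows (force `g = marchioroForce α`, momentum `m`, `m 0 ≠ 0`) with bounded
scalar variance is not anomalous. [folklore] -/
theorem not_anomalous_of_isCandidate_swept (α : ℝ) {m : E²} (hm : m 0 ≠ 0)
    {g : UnitAddTorus (Fin 2) → E²} (hadm : IsAdmissible g h) {ν : ℕ → ℝ}
    {v₀ : ℕ → UnitAddTorus (Fin 2) → E²} {θ₀ : ℕ → UnitAddTorus (Fin 2) → ℝ} {θ : ℕ → ℝ → UnitAddTorus (Fin 2) → ℝ}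
    (hcand : IsCandidate g h ν v₀ (fun j => marchioroSweptState α (ν j) m) θ₀ θ) (hV : VarianceBounded θ) :
    ¬ Anomalous ν θ := by
  obtain ⟨E, hE⟩ := hV
  exact sweptMarchioro_not_anomalous α hm hadm.smooth_h hadm.zeroMean_h hcand.pos hcand.tendsto hcand.memLp hcand.weak hE

end Swept

end Summit.AnomalousDissipation.AnomalousDissipation.Theorems.ScalarAnomalySteadySourceFormal.Negative
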